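import Summits.QuantumFields.YangMills.Theorems.LuscherReductionOneSiteLevelsKacInner
import Summits.QuantumFields.YangMills.Theorems.LuscherReductionOneSiteLevelsKacRemainder

/-!
# Crux RED `RunningReduction`, line «KTR» PART 8 — stub `TT.stub_oneSiteTail`, tool 4:
# FLATTEN + HEAT-SMOOTH read backwards (an upper jump bound ⟹ an upper energy bound of the smoothed flat representative)

Support module for crux `RunningReduction` (route `LuscherReduction`, item stmt-QuantumFields-19978), registered stub
`TT.stub_oneSiteTail` (KTR PART 8; plan of record = ym-cruxidea-19978-2 g10's STUB-READING §3 step 3), fleet base ym-luscher-20007-p1 (gen 4).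

ONE's layer II (`jumpEnergyLower_of_flatKac`, seat ym-luscher-20007-p2) bounds the lattice jump energy of `g = e^{−BS/2}cos Θ_B ψ` from BELOW by
the flat Kac form of the gnomonic representative `G = gFlat B ψ` through four per-function inequalities (mass `integral_sq_le_of_chartRep`,
magnetic minorant `integral_action_mul_sq_ge`, kinetic minorant `latticeJump_ge_flatJumpBall`, Gaussian tail `flatJump_le_flatJumpBall_add_exp`),
and layer III smooths (`energyForm_heatSmooth_half_le`, `flatJump_eq_mass_defect`).  The SAME inequalities read in the other direction give,
for the B-uniform window count:

* `tail_coeff_le` — `t⁻¹·√2⁹·e^{−49/(4t²)} ≤ 2t`;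
* `flat_energy_of_jump_le` — if `latticeJump B g + ∫B·S·g² ≤ a·∫g²` (`0 ≤ a`, `t = λ_b ≤ 1/600`), then with `G = gFlat B ψ`,
  `u = heatSmooth (t/2) G`: `u ∈ IsKacFn`, `𝔮(u) ≤ (4a/t + 4706)·∫G²`, `(1 − 4a − 2t²)·∫G² ≤ ∫u²`, and `∫g² ≤ 8ρ₀∫G²`
  (`ρ₀ = (t/2)⁹(2π²)^{−3}`) — constants crude on purpose (only polynomial level counting is at stake).

HONEST FRAMING: per-function bookkeeping for the ONE-SITE (`L = 1`) three-matrix `SU(2)` model, femto rung R2b1; nothing here is infinite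
volume, a mass gap or Clay.  Sorry-free, no new definitions, no named-fact hypotheses.
-/

set_option autoImplicit false

noncomputable section

open MeasureTheory Filter Topology Real
open scoped ENNReal
open Literature.MathematicalPhysics.QuantumFieldTheory
open Literature.MathematicalPhysics.QuantumLattice
open Literature.Analysis.OperatorTheory.YMMatrixModel

namespace Summit.QuantumFields.YangMills.Theorems.FemtoTransferGap.OST

open Summit.QuantumFields.YangMills.Theorems.FemtoTransferGap

/-- The Gaussian tail coefficient: `t⁻¹·√2⁹·e^{−49/(4t²)} ≤ 2t` for `t > 0` (`e^{−y} ≤ 1/y`, `√2⁹ ≤ 23`). [folklore] -/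
theorem tail_coeff_le {t : ℝ} (ht : 0 < t) : 1 / t * (Real.sqrt 2 ^ 9 * Real.exp (-(49 / (4 * t ^ 2)))) ≤ 2 * t := by
  have hexp : Real.exp (-(49 / (4 * t ^ 2))) ≤ 4 * t ^ 2 / 49 := by
    have hx : 0 < 49 / (4 * t ^ 2) := by positivity
    have h1 : 49 / (4 * t ^ 2) ≤ Real.exp (49 / (4 * t ^ 2)) := by linarith [Real.add_one_le_exp (49 / (4 * t ^ 2))]
    rw [Real.exp_neg]
    calc (Real.exp (49 / (4 * t ^ 2)))⁻¹ ≤ (49 / (4 * t ^ 2))⁻¹ := inv_anti₀ hx h1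
      _ = 4 * t ^ 2 / 49 := by rw [inv_div]
  have hs := sqrt_two_pow_nine_le
  calc 1 / t * (Real.sqrt 2 ^ 9 * Real.exp (-(49 / (4 * t ^ 2)))) ≤ 1 / t * (23 * (4 * t ^ 2 / 49)) := by
        refine mul_le_mul_of_nonneg_left (mul_le_mul hs hexp (by positivity) (by norm_num)) (by positivity)
    _ = 92 / 49 * t := by field_simp; norm_num
    _ ≤ 2 * t := by linarith

/-- The real arithmetic of the flattening step (crude constants): from the mass bound, the kinetic and magnetic minorants, the Gaussian
tail and the jump hypothesis, `FJ + Vf ≤ (4a/t + 2t)·m`. [folklore] -/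
theorem flat_arith {t a ρ₀ m M0 FJB Vf Vl J FJ : ℝ} (ht : 0 < t) (ht600 : t ≤ 1 / 600) (hρ₀ : 0 < ρ₀) (ha0 : 0 ≤ a)
    (hm0 : 0 ≤ m) (hFJB0 : 0 ≤ FJB) (hVf0 : 0 ≤ Vf)
    (hM : M0 ≤ 8 * ρ₀ * m) (hJ : 8 * ρ₀ * t * (1 - 294 * t) ^ 2 * FJB ≤ J) (hV : 8 * ρ₀ * t * (1 - 98 * t) * Vf ≤ Vl)
    (hT : FJ ≤ FJB + 1 / t * (Real.sqrt 2 ^ 9 * Real.exp (-(49 / (4 * t ^ 2)))) * m) (hjump : J + Vl ≤ a * M0) :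
    FJ + Vf ≤ (4 * a / t + 2 * t) * m := by
  have hq1 : (1 : ℝ) / 4 ≤ (1 - 294 * t) ^ 2 := by nlinarith
  have hq2 : (1 : ℝ) / 4 ≤ 1 - 98 * t := by linarith
  have h8 : 0 ≤ 8 * ρ₀ * t := by positivity
  have h1 : 8 * ρ₀ * t * (1 / 4) * FJB ≤ J :=
    le_trans (mul_le_mul_of_nonneg_right (mul_le_mul_of_nonneg_left hq1 h8) hFJB0) hJ
  have h2 : 8 * ρ₀ * t * (1 / 4) * Vf ≤ Vl :=
    le_trans (mul_le_mul_of_nonneg_right (mul_le_mul_of_nonneg_left hq2 h8) hVf0) hV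
  have h4 : a * M0 ≤ a * (8 * ρ₀ * m) := mul_le_mul_of_nonneg_left hM ha0
  have hsum : 8 * ρ₀ * t * (1 / 4) * (FJB + Vf) ≤ 8 * ρ₀ * a * m := by linarith
  have hpos : 0 < 8 * ρ₀ * t * (1 / 4) := by positivity
  have hFV : FJB + Vf ≤ 4 * a / t * m := by
    rw [show 4 * a / t * m = 8 * ρ₀ * a * m / (8 * ρ₀ * t * (1 / 4)) by field_simp]
    rw [le_div_iff₀ hpos]; linarith
  have htail := mul_le_mul_of_nonneg_right (tail_coeff_le ht) hm0
  have e : (4 * a / t + 2 * t) * m = 4 * a / t * m + 2 * t * m := by ring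
  linarith

/-- The real arithmetic of the heat step: energy `≤ (4a/t + 4706)·m` and mass `≥ (1 − 4a − 2t²)·m`. [folklore] -/
theorem heat_arith {t a m FJ Vf X I E : ℝ} (ht : 0 < t) (ht600 : t ≤ 1 / 600) (hm0 : 0 ≤ m) (hVf0 : 0 ≤ Vf)
    (hKac : FJ + Vf ≤ (4 * a / t + 2 * t) * m) (hheat : E ≤ FJ + Vf + 96 * t * X + 64 * t ^ 2 * m) (hX : X ≤ 49 / t * m)
    (hmd : FJ = 1 / t * (m - I)) :
    E ≤ (4 * a / t + 4706) * m ∧ (1 - 4 * a - 2 * t ^ 2) * m ≤ I := by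
  constructor
  · have h1 : 96 * t * X ≤ 96 * 49 * m := by
      calc 96 * t * X ≤ 96 * t * (49 / t * m) := mul_le_mul_of_nonneg_left hX (by positivity)
        _ = 96 * 49 * m := by field_simp
    have h2 : 64 * t ^ 2 * m ≤ 1 * m := mul_le_mul_of_nonneg_right (by nlinarith) hm0
    have h3 : 2 * t * m ≤ 1 * m := mul_le_mul_of_nonneg_right (by linarith) hm0
    have e4 : (4 * a / t + 2 * t) * m = 4 * a / t * m + 2 * t * m := by ring
    have e5 : (4 * a / t + 4706) * m = 4 * a / t * m + 4706 * m := by ring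
    linarith
  · have e : I = m - t * FJ := by rw [hmd]; field_simp; ring
    rw [e]
    have hFJ : FJ ≤ (4 * a / t + 2 * t) * m := by linarith
    have h1 : t * FJ ≤ t * ((4 * a / t + 2 * t) * m) := mul_le_mul_of_nonneg_left hFJ ht.le
    have e2 : t * ((4 * a / t + 2 * t) * m) = (4 * a + 2 * t ^ 2) * m := by field_simp
    nlinarith

/-- **FLATTEN + HEAT backwards.**  Let `B ≥ 2`, `t = λ_b ≤ 1/600`, `ψ` physical, `g = magWeight B (cos Θ_B ψ)` with
`latticeJump B g + ∫ B·S·g² ≤ a ∫g²` (`0 ≤ a`).  Then for `G = gFlat B ψ` and `u = heatSmooth (t/2) G`: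
`u ∈ IsKacFn`, `𝔮(u) ≤ (4a/t + 4706) ∫G²`, `(1 − 4a − 2t²) ∫G² ≤ ∫u²`, and `∫g² ≤ 8ρ₀ ∫G²`, `ρ₀ = (t/2)⁹ (2π²)^{−3}`.
[cite: Luscher1983, §3] [cite: SimonB1983DiscreteSpectrum, §3] [cite: LiebYau1988, (2.9)–(2.11)] -/
theorem flat_energy_of_jump_le {B : ℝ} (hB2 : 2 ≤ B) (ht600 : bareLambda B ≤ 1 / 600) {ψ : Cfg → ℝ} (hψ : IsPhys ψ)
    {a : ℝ} (ha0 : 0 ≤ a)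
    (hjump : latticeJump B (magWeight B (fun U => Real.cos (onePhase (onePhaseScale B) U) * ψ U)) +
        ∫ U, B * wilsonAction su2Rep U * magWeight B (fun U => Real.cos (onePhase (onePhaseScale B) U) * ψ U) U ^ 2 ∂cfgMeasure
      ≤ a * ∫ U, magWeight B (fun U => Real.cos (onePhase (onePhaseScale B) U) * ψ U) U ^ 2 ∂cfgMeasure) :
    IsKacFn (heatSmooth (bareLambda B / 2) (gFlat B ψ)) ∧
    energyForm (heatSmooth (bareLambda B / 2) (gFlat B ψ)) ≤ (4 * a / bareLambda B + 4706) * ∫ y, gFlat B ψ y ^ 2 ∧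
    (1 - 4 * a - 2 * bareLambda B ^ 2) * ∫ y, gFlat B ψ y ^ 2 ≤ ∫ x, heatSmooth (bareLambda B / 2) (gFlat B ψ) x ^ 2 ∧
    ∫ U, magWeight B (fun U => Real.cos (onePhase (onePhaseScale B) U) * ψ U) U ^ 2 ∂cfgMeasure
      ≤ 8 * ((bareLambda B / 2) ^ 9 * ((2 * π ^ 2)⁻¹) ^ 3) * ∫ y, gFlat B ψ y ^ 2 := by
  -- parameters at coupling `B`: `t = λ_b`, `μ = t/2`, `R₀ = 7/√t`
  have hBpos : 0 < B := by linarith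
  have ht : 0 < bareLambda B := bareLambda_pos' hBpos
  have ht4 : bareLambda B ≤ 1 / 4 := by linarith
  have hBt : B = 2 / bareLambda B ^ 3 := by
    have h := bareLambda_cube hBpos
    field_simp
    linarith
  have hμ : 0 < bareLambda B / 2 := by positivity
  have hsq : Real.sqrt (bareLambda B) ^ 2 = bareLambda B := Real.sq_sqrt ht.le
  have hsqpos : 0 < Real.sqrt (bareLambda B) := Real.sqrt_pos.2 ht
  have hR₀ : (0 : ℝ) ≤ 7 / Real.sqrt (bareLambda B) := by positivity
  have hμR₀ : (bareLambda B / 2) ^ 2 * (7 / Real.sqrt (bareLambda B)) ^ 2 = 49 / 4 * bareLambda B := by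
    rw [div_pow, div_pow, hsq]; field_simp; ring
  have hρ₀ : 0 < (bareLambda B / 2) ^ 9 * ((2 * π ^ 2)⁻¹) ^ 3 := by positivity
  have hwin6 : 6 * ((bareLambda B / 2) ^ 2 * (7 / Real.sqrt (bareLambda B)) ^ 2) ≤ 1 := by rw [hμR₀]; linarith
  have h4R : (bareLambda B / 2) ^ 2 * (2 * (7 / Real.sqrt (bareLambda B))) ^ 2 =
      4 * ((bareLambda B / 2) ^ 2 * (7 / Real.sqrt (bareLambda B)) ^ 2) := by ring
  have hR6 : 6 * ((bareLambda B / 2) ^ 2 * (2 * (7 / Real.sqrt (bareLambda B))) ^ 2) ≤ 1 := by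
    rw [h4R, hμR₀]; linarith
  -- the test function, its electric and flat representatives
  obtain ⟨Cψ, hCψ⟩ := hψ.bounded
  have hfphys : IsPhys (fun U => Real.cos (onePhase (onePhaseScale B) U) * ψ U) := isPhys_cos_onePhase_mul _ hψ
  have hfb' : ∀ U : Cfg, |Real.cos (onePhase (onePhaseScale B) U) * ψ U| ≤ Cψ := fun U => by
    rw [abs_mul]
    exact (mul_le_of_le_one_left (abs_nonneg _) (Real.abs_cos_le_one _)).trans (hCψ U)
  set g : Cfg → ℝ := magWeight B (fun U => Real.cos (onePhase (onePhaseScale B) U) * ψ U) with hg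
  have hgm : Measurable g := measurable_magWeight B hfphys.measurable
  have hgb : ∀ U, |g U| ≤ Cψ := magWeight_bounded hBpos.le hfb'
  set G : ZM → ℝ := gFlat B ψ with hG
  have hrep : ∀ σ y, g (gnChart (bareLambda B / 2) σ y) = G y := fun σ y => magWeight_cos_gnChart hψ B σ y
  have hGm : Measurable G := measurable_gFlat B hψ.measurable
  have hGb : ∀ y, |G y| ≤ Cψ := abs_gFlat_le hBpos.le hCψ
  have hGinv : IsGaugeInv G := isGaugeInv_gFlat B hψ
  have hGsupp : ∀ y, G y ≠ 0 → ‖y‖ ≤ 7 / Real.sqrt (bareLambda B) := fun y hy => norm_le_of_gFlat_ne_zero hBpos ht4 hy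
  obtain ⟨hGi, hGw, hGV, hGx2, hG2i⟩ := datum_integrable hGm hGb hGsupp
  -- the four analytic inputs of layer II
  have hM : ∫ U, g U ^ 2 ∂cfgMeasure ≤ 8 * ((bareLambda B / 2) ^ 9 * ((2 * π ^ 2)⁻¹) ^ 3) * ∫ y, G y ^ 2 :=
    integral_sq_le_of_chartRep hμ hgm ⟨Cψ, hgb⟩ hrep hG2i
  have hV := integral_action_mul_sq_ge hBpos.le hμ hgm ⟨Cψ, hgb⟩ hrep hGsupp hwin6 hGV
  have hJ := latticeJump_ge_flatJumpBall ht hgm hgb hGm hGb hrep hR6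
  rw [← hBt] at hJ
  have hT := flatJump_le_flatJumpBall_add_exp ht hGm hGb hR₀ hGsupp
  have e8 : 8 * B * (bareLambda B / 2) ^ 4 = bareLambda B := by
    linear_combination (bareLambda B / 2) * bareLambda_cube hBpos
  have e98 : 1 - 8 * ((bareLambda B / 2) ^ 2 * (7 / Real.sqrt (bareLambda B)) ^ 2) = 1 - 98 * bareLambda B := by
    rw [hμR₀]; ring
  have e294 : 1 - 6 * ((bareLambda B / 2) ^ 2 * (2 * (7 / Real.sqrt (bareLambda B))) ^ 2) = 1 - 294 * bareLambda B := by
    rw [h4R, hμR₀]; ring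
  have e49 : (7 / Real.sqrt (bareLambda B)) ^ 2 / (4 * bareLambda B) = 49 / (4 * bareLambda B ^ 2) := by
    rw [div_pow, hsq]; field_simp; ring
  rw [e8, e98] at hV
  rw [e294] at hJ
  rw [e49] at hT
  -- arithmetic (abstract lemmas; no `linarith` over the heavy context)
  have hm0 : 0 ≤ ∫ y, G y ^ 2 := integral_nonneg fun y => sq_nonneg _
  have hVf0 : 0 ≤ ∫ y, luscherPotential y * G y ^ 2 :=
    integral_nonneg fun y => mul_nonneg (luscherPotential_nonneg y) (sq_nonneg _)
  have hKac := flat_arith ht ht600 hρ₀ ha0 hm0 (flatJumpBall_nonneg ht _ _) hVf0 hM hJ hV hT hjump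
  -- heat smoothing
  have hheat := energyForm_heatSmooth_half_le ht hGm hGb hGi hGinv hGw hGV
  rw [kacForm] at hheat
  have hmom : ∫ y, ‖y‖ ^ 2 * G y ^ 2 ≤ 49 / bareLambda B * ∫ y, G y ^ 2 := by
    rw [← integral_const_mul]
    refine integral_mono hGx2 (hG2i.const_mul _) fun y => ?_
    by_cases hy : G y = 0
    · simp [hy]
    · have hyle := hGsupp y hy
      have hsq' : ‖y‖ ^ 2 ≤ (7 / Real.sqrt (bareLambda B)) ^ 2 := pow_le_pow_left₀ (norm_nonneg _) hyle 2
      rw [div_pow, hsq] at hsq'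
      have : ‖y‖ ^ 2 ≤ 49 / bareLambda B := by norm_num at hsq'; exact hsq'
      exact mul_le_mul_of_nonneg_right this (sq_nonneg _)
  have hmd := flatJump_eq_mass_defect ht hGm hGb hGi
  obtain ⟨hEn, hmass⟩ := heat_arith ht ht600 hm0 hVf0 hKac hheat hmom hmd
  exact ⟨isKacFn_heatSmooth (half_pos ht) hGm hGb hGi hGinv hGw, hEn, hmass, hM⟩

end Summit.QuantumFields.YangMills.Theorems.FemtoTransferGap.OST

end
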